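import Mathlib
import Summits.MatrixMultiplication.MatrixMultiplication.Theorems.SoloBlindTypeCoords

/-!
# Zero-sum-freeness across an independent block, in coordinates

Third plumbing lemma of the kernel plan for the type model (solo-blind programme, K3.35):
with `β = Basis.sumExtend hli` extending the independent block `(h i)_{i ∈ B}`, an element `v`
avoids all translates `-(∑_{i∈A} h i)` (`A ⊆ B`) iff some block coordinate of `v` equals `1` or
some ambient coordinate of `v` is nonzero.  Applied to `v = ∑_{x ∈ T} h x` (`T ⊆ X`) this is the
"hitting constraint" form of zero-sum-freeness of `B ∪ X` used by the per-family type oracle;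
applied to `v = ∑_{x∈T} h x + τ` it is the form of `H`-goodness.  Nothing here bears on `ω`.
-/

namespace Summit.MatrixMultiplication.MatrixMultiplication.Theorems

open Finset Module

variable {G : Type*} [AddCommGroup G] [Module (ZMod 3) G] {ι : Type*} [DecidableEq ι]

/-- In `ZMod 3`, `-c = 1` iff `c = 2`. -/
theorem soloBlind_zmod3_neg_eq_one (c : ZMod 3) : -c = 1 ↔ c = 2 := by
  revert c; decide

/-- `v` is the negative of a subset sum of the block iff its ambient coordinates vanish and its
block coordinates lie in `{0,2}`. -/
theorem soloBlind_negSubsetSum_iff_coords (h : ι → G) (B : Finset ι)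
    (hli : LinearIndependent (ZMod 3) (fun i : B => h i)) (v : G) :
    (∃ A : Finset B, ∑ i ∈ A, h (i : ι) = -v) ↔
      (∀ j : Basis.sumExtendIndex hli, (Basis.sumExtend hli).coord (Sum.inr j) v = 0) ∧
      (∀ i : B, (Basis.sumExtend hli).coord (Sum.inl i) v = 0 ∨
        (Basis.sumExtend hli).coord (Sum.inl i) v = 2) := by
  rw [soloBlind_subsetSum_iff_coords h B hli (-v)]
  simp only [map_neg, neg_eq_zero, soloBlind_zmod3_neg_eq_one]

/-- HITTING FORM. `v + ∑_{i∈A} h i ≠ 0` for every `A ⊆ B` iff some block coordinate of `v`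
equals `1` or some ambient coordinate of `v` is nonzero. -/
theorem soloBlind_noZeroSum_iff_hit (h : ι → G) (B : Finset ι)
    (hli : LinearIndependent (ZMod 3) (fun i : B => h i)) (v : G) :
    (∀ A : Finset B, v + ∑ i ∈ A, h (i : ι) ≠ 0) ↔
      (∃ i : B, (Basis.sumExtend hli).coord (Sum.inl i) v = 1) ∨
      (∃ j : Basis.sumExtendIndex hli, (Basis.sumExtend hli).coord (Sum.inr j) v ≠ 0) := by
  have key : (∀ A : Finset B, v + ∑ i ∈ A, h (i : ι) ≠ 0) ↔
      ¬ ∃ A : Finset B, ∑ i ∈ A, h (i : ι) = -v := by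
    constructor
    · rintro hall ⟨A, hA⟩
      exact hall A (by rw [hA, add_neg_cancel])
    · intro hno A hz
      exact hno ⟨A, by rw [eq_neg_iff_add_eq_zero, add_comm]; exact hz⟩
  rw [key, soloBlind_negSubsetSum_iff_coords h B hli v]
  push Not
  constructor
  · intro H
    by_cases hamb : ∃ j : Basis.sumExtendIndex hli, (Basis.sumExtend hli).coord (Sum.inr j) v ≠ 0
    · exact Or.inr hamb
    · push Not at hamb
      obtain ⟨i, hi0, hi2⟩ := H hamb
      left
      refine ⟨i, ?_⟩
      have hc : ∀ c : ZMod 3, c ≠ 0 → c ≠ 2 → c = 1 := by decide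
      exact hc _ hi0 hi2
  · rintro (⟨i, hi⟩ | ⟨j, hj⟩)
    · intro _
      refine ⟨i, ?_, ?_⟩
      · rw [hi]; decide
      · rw [hi]; decide
    · intro hamb
      exact absurd (hamb j) hj

end Summit.MatrixMultiplication.MatrixMultiplication.Theorems
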